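import Mathlib
import Summits.Ventures.PercRepro2.Defs
import Summits.Ventures.PercRepro2.Graph
import Summits.Ventures.PercRepro2.OneColourSwitch
import Summits.Ventures.PercRepro2.RegionHubSign
import Summits.Ventures.PercRepro2.SideSwitch
import Summits.Ventures.PercRepro2.TermSwitchDefs
import Summits.Ventures.PercRepro2.TermSwitchReach
import Summits.Ventures.PercRepro2.M9NoPocketDefs
import Summits.Ventures.PercRepro2.M9GeneralDSplit
import Summits.Ventures.PercRepro2.M9LinkedHD
import Summits.Ventures.PercRepro2.M9HDRSplit
import Summits.Ventures.PercRepro2.M9WorldSwitch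
import Summits.Ventures.PercRepro2.M9WorldSwitchLink

/-!
# The linking components of the `Y`-world, and the injectivity of the switch `ψ` (blind cell
PercRepro2, p3 g30, 2026-08-28; `proofs/P3-HDR.md` §4, THEOREM ψ (iii))

The mirror of `M9WorldSwitchLink` on the `Y`-side: `G`-connectivity within `K₂ ∖ {r, s}`
(`gconnK`, `gcompK`), the carrying configuration `compY` and the **`Y`-linking set** `ylinkSet`.
Main theorem (`ylinkSet_flipTouch_linkSet`): on a `Sep ∧ DOne` colouring with `d ∈ K₂ ∖ M₂` and
`r ≁_Y s`, the `Y`-linking set of the switched colouring `flipTouch (linkSet ω) ω` is exactly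
`linkSet ω` — the switched components are the only `Y`-linking ones (the old `Y`-world has no
`Y`-connection `r ~ s`, and no edge joins it to the switched components).  Hence the switch
`ψ ω = flipTouch (linkSet ω) ω` is injective on such colourings (`flipTouch_linkSet_injOn`):
`ω = flipTouch (ylinkSet (ψ ω)) (ψ ω)`.  Own work; std axioms.
-/

namespace Summit.Ventures.PercRepro2

namespace NoPocket

open Finset Classical RegionHub OneColourSwitch SideSwitch TermSwitch

variable {V : Type*} {E : Type*}

section YLink

variable (ends : E → Sym2 V) (r s : V) (ω : Config E)

/-- The edges inside `K₂ ∖ {r, s}`, all open. -/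
noncomputable def allK : Config E :=
  fun e => if e ∈ within ends ((K2 ends r s ω) \ {r, s}) then true else false

/-- `G`-connectivity within `K₂ ∖ {r, s}`. -/
def gconnK (x y : V) : Prop := Conn ends (allK ends r s ω) x y

/-- The `G`-component of `y` within `K₂ ∖ {r, s}`. -/
def gcompK (y : V) : Set V := {x | gconnK ends r s ω x y}

/-- The `Y`-edges inside `gcompK y ∪ {r, s}`. -/
noncomputable def compY (y : V) : Config E :=
  fun e => if e ∈ within ends (gcompK ends r s ω y ∪ {r, s}) ∧ ω e = true then true else false

/-- The `Y`-linking set: the vertices of `K₂ ∖ {r, s}` whose component carries `r ~_Y s`. -/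
def ylinkSet : Set V :=
  {x | x ∈ K2 ends r s ω ∧ x ≠ r ∧ x ≠ s ∧ Conn ends (compY ends r s ω x) r s}

variable {ends r s ω}

/-- An open edge of `allK` lies inside `K₂ ∖ {r, s}`. -/
lemma mem_within_of_allK {e : E} (h : allK ends r s ω e = true) :
    e ∈ within ends ((K2 ends r s ω) \ {r, s}) := by
  by_contra h'
  simp only [allK, if_neg h'] at h
  exact absurd h (by decide)

/-- `gconnK` is symmetric. -/
lemma gconnK_symm {x y : V} (h : gconnK ends r s ω x y) : gconnK ends r s ω y x := conn_symm h

/-- Membership in `K₂ ∖ {r, s}`, unfolded. -/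
lemma mem_K2_diff_iff {x : V} :
    x ∈ (K2 ends r s ω) \ {r, s} ↔ x ∈ K2 ends r s ω ∧ x ≠ r ∧ x ≠ s := by
  simp only [Set.mem_sdiff, Set.mem_insert_iff, Set.mem_singleton_iff, not_or]

variable {d : V} {S : Set V}

/-- **Inside the switched `W`-world, `G`-connectivity within `M₂ ∖ {r, s}` becomes
`G`-connectivity within the new `Y`-world.** -/
lemma gconnK_flipTouch_of_gconnM (hD : DOne ends r s d ω) (hM : d ∉ M2 ends r s ω)
    (hS : WClosed ends r s ω S) {x z : V} (hx : x ∈ S) (h : gconnM ends r s ω x z) :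
    gconnK ends r s (flipTouch ends S ω) x z ∧ z ∈ S := by
  have key : ∀ v, v ∈ {y | gconnK ends r s (flipTouch ends S ω) x y ∧ y ∈ S} → ∀ y,
      (openGraph ends (allM ends r s ω)).Adj v y →
        y ∈ {y | gconnK ends r s (flipTouch ends S ω) x y ∧ y ∈ S} := by
    intro v ⟨hv, hvS⟩ y hvy
    obtain ⟨_, e, he, hends⟩ := openGraph_adj.1 hvy
    obtain ⟨a, ha, b, hb, hab⟩ := mem_within_of_allM he
    have hyM : y ∈ M2 ends r s ω ∧ y ≠ r ∧ y ≠ s := by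
      rw [hends] at hab
      rcases Sym2.eq_iff.1 hab with ⟨_, hyb⟩ | ⟨_, hya⟩
      · rw [hyb]; exact mem_M2_diff_iff.1 hb
      · rw [hya]; exact mem_M2_diff_iff.1 ha
    have hyS : y ∈ S := hS.closed e v y hends hvS hyM.1 hyM.2.1 hyM.2.2
    refine ⟨conn_trans hv (conn_of_openAdj ⟨e, ?_, hends⟩), hyS⟩
    have hw : e ∈ within ends ((K2 ends r s (flipTouch ends S ω)) \ {r, s}) := by
      obtain ⟨hvM, hvr, hvs⟩ := hS.subset v hvS
      refine ⟨v, mem_K2_diff_iff.2 ⟨?_, hvr, hvs⟩, y, mem_K2_diff_iff.2 ⟨?_, hyM.2.1, hyM.2.2⟩, hends⟩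
      · rw [K2_flipTouch hD hM hS]; exact Or.inr hvS
      · rw [K2_flipTouch hD hM hS]; exact Or.inr hyS
    unfold allK
    rw [if_pos hw]
  exact mem_of_conn_of_closed key ⟨conn_refl _ _ _, hx⟩ h

/-- **The component of an old `Y`-vertex within the new `Y`-world stays in the old one**: no edge
joins the switched components to the old `Y`-world. -/
lemma mem_K2_of_gconnK_flipTouch (hD : DOne ends r s d ω) (hM : d ∉ M2 ends r s ω)
    (hS : WClosed ends r s ω S) {x z : V} (hx : x ∈ K2 ends r s ω) (hxr : x ≠ r) (hxs : x ≠ s)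
    (h : gconnK ends r s (flipTouch ends S ω) z x) : z ∈ K2 ends r s ω ∧ z ≠ r ∧ z ≠ s := by
  have key : ∀ v, v ∈ {y | y ∈ K2 ends r s ω ∧ y ≠ r ∧ y ≠ s} → ∀ y,
      (openGraph ends (allK ends r s (flipTouch ends S ω))).Adj v y →
        y ∈ {y | y ∈ K2 ends r s ω ∧ y ≠ r ∧ y ≠ s} := by
    intro v ⟨hvK, hvr, hvs⟩ y hvy
    obtain ⟨_, e, he, hends⟩ := openGraph_adj.1 hvy
    obtain ⟨a, ha, b, hb, hab⟩ := mem_within_of_allK he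
    have hy' : y ∈ K2 ends r s (flipTouch ends S ω) ∧ y ≠ r ∧ y ≠ s := by
      rw [hends] at hab
      rcases Sym2.eq_iff.1 hab with ⟨_, hyb⟩ | ⟨_, hya⟩
      · rw [hyb]; exact mem_K2_diff_iff.1 hb
      · rw [hya]; exact mem_K2_diff_iff.1 ha
    obtain ⟨hyK', hyr, hys⟩ := hy'
    rw [K2_flipTouch hD hM hS] at hyK'
    rcases hyK' with hyK | hyS
    · exact ⟨hyK, hyr, hys⟩
    · exfalso
      obtain ⟨hyM, _, _⟩ := hS.subset y hyS
      exact no_edge_M2_K2 hD hM (by rw [hends, Sym2.eq_swap]) hyM hyr hys hvK hvr hvs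
  exact mem_of_conn_of_closed key ⟨hx, hxr, hxs⟩ (conn_symm h)

/-- **The `Y`-linking set of the switched colouring is the switched linking set.** -/
theorem ylinkSet_flipTouch_linkSet (hrs : r ≠ s) (hno : ∀ e, ends e ≠ s(r, s))
    (hD : DOne ends r s d ω) (hM : d ∉ M2 ends r s ω) (hY : ¬ Conn ends ω r s) :
    ylinkSet ends r s (flipTouch ends (linkSet ends r s ω) ω) = linkSet ends r s ω := by
  have hS0 : WClosed ends r s ω (linkSet ends r s ω) := linkSet_wClosed
  generalize hSeq : linkSet ends r s ω = S at hS0 ⊢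
  have hS : WClosed ends r s ω S := hS0
  ext x
  constructor
  · rintro ⟨hxK', hxr, hxs, hc⟩
    by_contra hxS
    -- `x` lies in the old `Y`-world; its carrying `Y`-connection is an old one
    have hxK : x ∈ K2 ends r s ω := by
      rw [K2_flipTouch hD hM hS] at hxK'
      rcases hxK' with h | h
      · exact h
      · exact absurd h hxS
    apply hY
    have key : ∀ v, v ∈ {y | Conn ends ω r y ∧ y ∉ S} → ∀ y,
        (openGraph ends (compY ends r s (flipTouch ends S ω) x)).Adj v y →
          y ∈ {y | Conn ends ω r y ∧ y ∉ S} := by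
      intro v ⟨hv, hvS⟩ y hvy
      obtain ⟨hne, e, he, hends⟩ := openGraph_adj.1 hvy
      have he' : e ∈ within ends (gcompK ends r s (flipTouch ends S ω) x ∪ {r, s}) ∧
          flipTouch ends S ω e = true := by
        by_contra h'
        simp only [compY, if_neg h'] at he
        exact absurd he (by decide)
      obtain ⟨⟨a, ha, b, hb, hab⟩, hfe⟩ := he'
      -- both ends lie in the old `Y`-world ∪ {r, s}, hence outside `S`
      have hK : ∀ c, c ∈ gcompK ends r s (flipTouch ends S ω) x ∪ {r, s} → c ∉ S := by
        intro c hc hcS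
        rcases hc with hc | hc
        · exact not_mem_S_of_mem_K2 hD hM hS (mem_K2_of_gconnK_flipTouch hD hM hS hxK hxr hxs hc).1 hcS
        · simp only [Set.mem_insert_iff, Set.mem_singleton_iff] at hc
          rcases hc with rfl | rfl
          · exact (hS.subset c hcS).2.1 rfl
          · exact (hS.subset c hcS).2.2 rfl
      have ht : e ∉ touches ends S := by
        rintro ⟨c, hcS, c', hcc'⟩
        rw [hab] at hcc'
        rcases Sym2.eq_iff.1 hcc' with ⟨hca, _⟩ | ⟨_, hca⟩
        · exact hK a ha (hca ▸ hcS)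
        · exact hK b hb (hca ▸ hcS)
      rw [flipTouch_of_notMem ends ht] at hfe
      refine ⟨conn_trans hv (conn_of_openAdj ⟨e, hfe, hends⟩), ?_⟩
      intro hyS
      apply ht
      exact mem_touches_of_ends hends (Or.inr hyS)
    exact (mem_of_conn_of_closed key ⟨conn_refl _ _ _, fun h => (hS.subset r h).2.1 rfl⟩ hc).1
  · intro hxS
    have hxL : x ∈ linkSet ends r s ω := hSeq ▸ hxS
    obtain ⟨hxM, hxr, hxs, hc⟩ := hxL
    refine ⟨by rw [K2_flipTouch hD hM hS]; exact Or.inr hxS, hxr, hxs, ?_⟩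
    -- the old carrying `W`-connection becomes a carrying `Y`-connection
    have key : ∀ v, v ∈ {y | Conn ends (compY ends r s (flipTouch ends S ω) x) r y} → ∀ y,
        (openGraph ends (compW ends r s ω x)).Adj v y →
          y ∈ {y | Conn ends (compY ends r s (flipTouch ends S ω) x) r y} := by
      intro v hv y hvy
      obtain ⟨hne, e, he, hends⟩ := openGraph_adj.1 hvy
      have he' : e ∈ within ends (gcomp ends r s ω x ∪ {r, s}) ∧ ω e = false := by
        by_contra h'
        simp only [compW, if_neg h'] at he
        exact absurd he (by decide)
      obtain ⟨⟨a, ha, b, hb, hab⟩, hw⟩ := he'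
      -- the ends inside the component lie in `S` and in the new component of `x`
      have hin : ∀ c, c ∈ gcomp ends r s ω x → c ∈ S ∧
          c ∈ gcompK ends r s (flipTouch ends S ω) x := by
        intro c hc
        obtain ⟨hg, hcS⟩ := gconnK_flipTouch_of_gconnM hD hM hS hxS (gconnM_symm hc)
        exact ⟨hcS, gconnK_symm hg⟩
      have hnotrs : ¬ (a ∈ ({r, s} : Set V) ∧ b ∈ ({r, s} : Set V)) := by
        rintro ⟨ha', hb'⟩
        simp only [Set.mem_insert_iff, Set.mem_singleton_iff] at ha' hb'
        rw [hends] at hab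
        rcases ha' with rfl | rfl <;> rcases hb' with rfl | rfl
        · rcases Sym2.eq_iff.1 hab with ⟨h1, h2⟩ | ⟨h1, h2⟩ <;> exact hne (h1.trans h2.symm)
        · exact hno e (by rw [hends, hab])
        · exact hno e (by rw [hends, hab, Sym2.eq_swap])
        · rcases Sym2.eq_iff.1 hab with ⟨h1, h2⟩ | ⟨h1, h2⟩ <;> exact hne (h1.trans h2.symm)
      have ht : e ∈ touches ends S := by
        rcases ha with ha | ha
        · exact ⟨a, (hin a ha).1, b, hab⟩
        · rcases hb with hb | hb
          · exact ⟨b, (hin b hb).1, a, by rw [hab, Sym2.eq_swap]⟩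
          · exact absurd ⟨ha, hb⟩ hnotrs
      have hfe : flipTouch ends S ω e = true := by
        rw [flipTouch_of_mem ends ht, hw]; rfl
      have hwithin : e ∈ within ends (gcompK ends r s (flipTouch ends S ω) x ∪ {r, s}) := by
        refine ⟨a, ?_, b, ?_, hab⟩
        · rcases ha with ha | ha
          · exact Or.inl (hin a ha).2
          · exact Or.inr ha
        · rcases hb with hb | hb
          · exact Or.inl (hin b hb).2
          · exact Or.inr hb
      have hcy : compY ends r s (flipTouch ends S ω) x e = true := by
        unfold compY
        rw [if_pos ⟨hwithin, hfe⟩]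
      exact conn_trans hv (conn_of_openAdj ⟨e, hcy, hends⟩)
    exact mem_of_conn_of_closed key (conn_refl _ _ _) hc

/-- **The switch `ψ` is injective** on `Sep ∧ DOne` colourings with `d ∈ K₂ ∖ M₂` and
`r ≁_Y s`: the source is recovered as the switch of the `Y`-linking set of the image. -/
theorem flipTouch_linkSet_injOn (hrs : r ≠ s) (hno : ∀ e, ends e ≠ s(r, s)) {ω₁ ω₂ : Config E}
    (hD₁ : DOne ends r s d ω₁) (hM₁ : d ∉ M2 ends r s ω₁) (hY₁ : ¬ Conn ends ω₁ r s)
    (hD₂ : DOne ends r s d ω₂) (hM₂ : d ∉ M2 ends r s ω₂) (hY₂ : ¬ Conn ends ω₂ r s)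
    (h : flipTouch ends (linkSet ends r s ω₁) ω₁ = flipTouch ends (linkSet ends r s ω₂) ω₂) :
    ω₁ = ω₂ := by
  have h1 := ylinkSet_flipTouch_linkSet hrs hno hD₁ hM₁ hY₁
  have h2 := ylinkSet_flipTouch_linkSet hrs hno hD₂ hM₂ hY₂
  have hS : linkSet ends r s ω₁ = linkSet ends r s ω₂ := by
    rw [← h1, ← h2, h]
  calc ω₁ = flipTouch ends (linkSet ends r s ω₁) (flipTouch ends (linkSet ends r s ω₁) ω₁) :=
        (flipTouch_flipTouch ends _ ω₁).symm
    _ = flipTouch ends (linkSet ends r s ω₂) (flipTouch ends (linkSet ends r s ω₂) ω₂) := by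
        rw [h, hS]
    _ = ω₂ := flipTouch_flipTouch ends _ ω₂

end YLink

end NoPocket

end Summit.Ventures.PercRepro2
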